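import Summits.AtomisticToContinuum.BoseEinsteinCondensation.Theses.BECJastrowEulerLagrange
import Summits.AtomisticToContinuum.BoseEinsteinCondensation.Theses.BECPeriodicReduction

/-!
# cstrat r1 — `JastrowShadowTransfer` (stmt-AtomisticToContinuum-13403) is `PeriodicBEC` in costume

The deciding crux of route-AtomisticToContinuum-BECJastrowEulerLagrange is
`JastrowShadowTransfer := JastrowTailRigidity → OptimalJastrowBEC → ⟨PeriodicBEC body⟩`.
The theorems below (sorry-free) show:

* `periodicBEC_imp_shadow` : `PeriodicBEC → JastrowShadowTransfer` — the periodic form of the summit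
  (stmt-AtomisticToContinuum-0826, the hypothesis of the shared bridge `BoundaryTransferWeak` stmt-0827)
  gives the crux outright, ignoring both Jastrow antecedents;
* `shadow_iff_periodicBEC` : under the two Jastrow-manifold antecedents the crux is *literally*
  `PeriodicBEC` (`Iff` by application / constant function);
* `not_shadow_iff` : refuting the crux = proving both antecedents and refuting `PeriodicBEC`;
* `closes_factors` : the route's deciding theorem factors through `PeriodicBEC`: what `closes`
  extracts from (hT, hB, hS) is exactly a proof of `PeriodicBEC`, which `BoundaryTransferWeak`
  turns into the Statement — the antecedents bear no load of their own.
-/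

namespace Summit.AtomisticToContinuum.BoseEinsteinCondensation.Cruxes.JastrowShadowTransfer.Costume

open Summit.AtomisticToContinuum.BoseEinsteinCondensation.Theses

/-- The periodic form of the summit (stmt-0826), by name from the (retired, file-kept) reduction route. -/
abbrev PeriodicBEC : Prop := BECPeriodicReduction.PeriodicBEC

/-- The conclusion of the crux is *verbatim* the body of `PeriodicBEC` (stmt-0826). -/
theorem conclusion_is_periodicBEC :
    BECJastrowEulerLagrange.JastrowShadowTransfer =
      (BECJastrowEulerLagrange.JastrowTailRigidity → BECJastrowEulerLagrange.OptimalJastrowBEC →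
        PeriodicBEC) := rfl

/-- The periodic summit gives the crux outright (both Jastrow antecedents discarded). -/
theorem periodicBEC_imp_shadow : PeriodicBEC → BECJastrowEulerLagrange.JastrowShadowTransfer :=
  fun h _ _ => h

/-- Under its own antecedents the crux *is* the periodic summit. -/
theorem shadow_iff_periodicBEC (hT : BECJastrowEulerLagrange.JastrowTailRigidity)
    (hB : BECJastrowEulerLagrange.OptimalJastrowBEC) :
    BECJastrowEulerLagrange.JastrowShadowTransfer ↔ PeriodicBEC :=
  ⟨fun hS => hS hT hB, fun h _ _ => h⟩

/-- Refuting the crux means proving both Jastrow-manifold statements AND refuting `PeriodicBEC`. -/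
theorem not_shadow_iff :
    ¬ BECJastrowEulerLagrange.JastrowShadowTransfer ↔
      (BECJastrowEulerLagrange.JastrowTailRigidity ∧ BECJastrowEulerLagrange.OptimalJastrowBEC ∧
        ¬ PeriodicBEC) := by
  constructor
  · intro h
    by_contra hc
    apply h
    intro hT hB
    by_contra hP
    exact hc ⟨hT, hB, hP⟩
  · rintro ⟨hT, hB, hP⟩ hS
    exact hP (hS hT hB)

/-- The route's deciding theorem factors through `PeriodicBEC`: the shared bridge
`BoundaryTransferWeak` (stmt-0827) is `∀ v, admissible v → PeriodicBEC-at-v → Dirichlet BEC at v`. -/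
theorem closes_factors (hP : PeriodicBEC) (hW : BECJastrowEulerLagrange.BoundaryTransferWeak) :
    _root_.BoseEinsteinCondensation :=
  fun v hv => hW v hv (hP v hv)

/-- … and conversely the only thing `closes` gets out of `(hT, hB, hS)` is `PeriodicBEC`. -/
theorem closes_eq :
    @BECJastrowEulerLagrange.closes =
      fun hT hB hS hW => closes_factors (hS hT hB) hW := rfl

end Summit.AtomisticToContinuum.BoseEinsteinCondensation.Cruxes.JastrowShadowTransfer.Costume
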